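import Summits.AnomalousDissipation.AnomalousDissipation.Theorems.SolenoidalFractalHomogenisationLagrangianStepDefs
import HarnessLib

/-!
# K1L `LagrangianRenormalisationStep` (stmt-AnomalousDissipation-24912), line `onelevel`: the SHARED DEFINITIONS of the re-cut cell package
# (helper; `--supports stmt-AnomalousDissipation-24912`)

Summits-side definitions file of route `SolenoidalFractalHomogenisation` — the SECOND shared-defs file of the K1L skeleton of record
`Summits/AnomalousDissipation/AnomalousDissipation/Cruxes/LagrangianRenormalisationStep/Lines/onelevel.lean` (crux-strategist cstrat-24912, registered
2026-08-28; Notes for provers §1): its block `## v10 definitions` (the named renormalisation recursion `renormStep` / `shapeSeq` / `chainTensor` and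
the re-cut cell package `WindowClause` / `SlowVectorClause` / `CellEnergyClauses` occurring in the registered signatures of `stub_cellLawV`,
`stub_cellEnergyT`, `stub_oneLevelL`) copied VERBATIM — same short names, same bodies, same binder order — into the namespace
`…Theorems.SolenoidalFractalHomogenisation.LagrangianStep` of the first shared-defs file `…LagrangianStepDefs` (p610007), which it imports.  Every
stub file for the three new stubs imports this file and `open`s that namespace so its `theorem stub_<name>` carries the registered signature
TEXTUALLY; the strategist/tenure seat re-registers the skeleton with the block replaced by this import (stub texts unchanged ⇒ credits carry over).
Definitions only — no theorems, no named facts, no instances, no notation; this is NOT a proof of anything (in particular not of Onsager's conjecture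
nor of anomalous dissipation).  Prover seat `ad-solenoidal-k2r-lowerlaw-p1` g5, 2026-08-28.
-/

set_option linter.dupNamespace false

namespace Summit.AnomalousDissipation.AnomalousDissipation.Theorems.SolenoidalFractalHomogenisation.LagrangianStep

open Literature.Analysis Literature.Analysis.FluidPDE Literature.Analysis.FunctionSpaces
open MeasureTheory Set Filter
open scoped ENNReal NNReal InnerProductSpace

noncomputable section

/-! ## v10 definitions of line `onelevel` (VERBATIM): the NAMED renormalisation recursion and the re-cut cell package -/

/-- One renormalisation step of the SHAPE (normalised viscosity tensor) through the package's large-gain map `Φ` with relative gain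
`g = gain / cellVisc²`: `S ↦ (S + g • Φ S)/(1 + g)` — the Taylor recursion of `Permissible` (`kbar m = kbar (m+1)·(1 + g_{m+1})`) read at
tensor level with the package's effective tensor `𝔸 + (c/ν)Φ(𝔸/ν)`, `𝔸 = ν S`, `ν = cellVisc (m+1)`; a convex combination for `g ≥ 0`. -/
def renormStep (Φ : Torus.Visc4 (Fin 3) → Torus.Visc4 (Fin 3)) (g : ℝ) (S : Torus.Visc4 (Fin 3)) : Torus.Visc4 (Fin 3) :=
  (1 / (1 + g)) • (S + g • Φ S)

/-- The shape chain below the top level `j`, indexed by DEPTH `d` (= level `j - d`): the isotropic shape at depth `0`, then one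
`renormStep` per level, with the relative gain `g (j - d)` of the level being integrated out. -/
def shapeSeq (Φ : Torus.Visc4 (Fin 3) → Torus.Visc4 (Fin 3)) (g : ℕ → ℝ) (j : ℕ) : ℕ → Torus.Visc4 (Fin 3)
  | 0 => Torus.isoVisc 1
  | d + 1 => renormStep Φ (g (j - d)) (shapeSeq Φ g j d)

/-- The renormalised viscosity TENSOR of `E` at level `m ≤ j` once the levels `m+1, …, j` are integrated out: `kbar m • S_{j-m}`. -/
def chainTensor {k : ℕ} (E : LatticeShear.LagrangianLatticeCarrier k) (Φ : Torus.Visc4 (Fin 3) → Torus.Visc4 (Fin 3)) (j m : ℕ) :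
    Torus.Visc4 (Fin 3) :=
  E.kbar m • shapeSeq Φ (fun i => E.gain / E.cellVisc i ^ 2) j (j - m)

/-- The WINDOW clause of `TensorCellPackage` (its first conjunct, verbatim): the nested windows `{OddSmall β} ∩ {NearIso (lo/λ) (hi λ)}`,
`λ ∈ [1, Λ]`, are `Φ`-invariant. -/
def WindowClause (Φ : Torus.Visc4 (Fin 3) → Torus.Visc4 (Fin 3)) (lo hi Λ β : ℝ) : Prop :=
  ∀ lam ∈ Set.Icc (1:ℝ) Λ, ∀ S : Torus.Visc4 (Fin 3), Torus.OddSmall S β → Torus.NearIso S (lo / lam) (hi * lam) → Torus.OddSmall (Φ S) β ∧ Torus.NearIso (Φ S) (lo / lam) (hi * lam)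

/-- The SLOW-VECTOR clause (V) of `TensorCellPackage` with the existence of the effective solution (v9 text, regrouped): for every cell
viscosity `ν < ν₀`, every `n`, every constant tensor `𝔸` in the `ν`-scaled nested window, every slow mode `ℓ` (`|ℓ|⌈K/ν⌉ ≤ n`) and unit
`p ⊥ ℓ`, the carrier-free problem with the EFFECTIVE tensor `(𝔸 + (c/ν)Φ(𝔸/ν))/n²` from the datum `Re e_ℓ·p` has a weak solution `v`, and the
sector-`ℓ` content of every cell solution `w` from the same datum stays `L²`-close to every such `v`, decay-relatively:
`2Σ_i|modeCoeff ℓ (w t − v t) i|² ≤ C²·(e·min(1, r̄t) + r̄P)²·E₀`, `e = C(ν^σ + (|ℓ|⌈K/ν⌉/n)^σ)`, `r̄ = 8π²|ℓ|² hiΛ(ν + c/ν)/n²`, `P = M·period/ν`. -/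
def SlowVectorClause {k : ℕ} (W : LatticeShear.LatticeWord k) (M : ℝ) (hM : 0 < M) (c : ℝ)
    (Φ : Torus.Visc4 (Fin 3) → Torus.Visc4 (Fin 3)) (lo hi Λ β σ C ν₀ K : ℝ) : Prop :=
      ∀ ν, ∀ hν : ν ∈ Set.Ioo 0 ν₀, ∀ n : ℕ, ∀ 𝔸 : Torus.Visc4 (Fin 3),
        Torus.OddSmall 𝔸 (ν * β) → (∃ lam ∈ Set.Icc (1:ℝ) Λ, Torus.NearIso 𝔸 (ν * (lo / lam)) (ν * (hi * lam))) →
        ∀ ℓ : Fin 3 → ℤ, ℓ ≠ 0 → ‖Torus.latticeVec ℓ‖ * (⌈K / ν⌉₊ : ℝ) ≤ n →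
        ∀ p : EuclideanSpace ℝ (Fin 3), ‖p‖ = 1 → ⟪p, Torus.latticeVec ℓ⟫_ℝ = 0 →
        ∀ T > (0:ℝ),
          (∃ v : ℝ → VF, Torus.IsWeakTensorPassiveVectorOn 0 (2 * T) ((1 / (n:ℝ) ^ 2) • (𝔸 + (c / ν) • Φ ((1 / ν) • 𝔸))) (fun _ _ => 0)
                (fun x => (UnitAddTorus.mFourier ℓ x).re • p) v) ∧
          ∀ w v : ℝ → VF,
            Torus.IsWeakTensorPassiveVectorOn 0 T ((1 / (n:ℝ) ^ 2) • 𝔸) (cellField W M hM ν hν.1 n) (fun x => (UnitAddTorus.mFourier ℓ x).re • p) w →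
            Torus.IsWeakTensorPassiveVectorOn 0 (2 * T) ((1 / (n:ℝ) ^ 2) • (𝔸 + (c / ν) • Φ ((1 / ν) • 𝔸))) (fun _ _ => 0)
                (fun x => (UnitAddTorus.mFourier ℓ x).re • p) v →
            ∀ᵐ t ∂(volume.restrict (Ioo 0 T)),
              2 * ∑ i, ‖modeCoeff ℓ (fun x => w t x - v t x) i‖ ^ 2
                  ≤ (C * (C * (ν ^ σ + (‖Torus.latticeVec ℓ‖ * (⌈K / ν⌉₊ : ℝ) / n) ^ σ) * min 1 ((8 * Real.pi ^ 2 * ‖Torus.latticeVec ℓ‖ ^ 2 * (hi * Λ) * (ν + c / ν) / (n:ℝ) ^ 2) * t) + (8 * Real.pi ^ 2 * ‖Torus.latticeVec ℓ‖ ^ 2 * (hi * Λ) * (ν + c / ν) / (n:ℝ) ^ 2) * (M * W.period / ν))) ^ 2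
                      * ∫ x, ‖(UnitAddTorus.mFourier ℓ x).re • p‖ ^ 2

/-- The CELL-ENERGY clauses (F) + (C) of `TensorCellPackage` (v9 text, regrouped; no shape map, no rate exponent): for every cell viscosity
`ν < ν₀`, every `n`, every constant tensor `𝔸` in the `ν`-scaled nested window — (F) FLUCTUATION DATA: a class datum `F` with NO modes below
`n/2` generates, along the cell carrier, solutions with `E ≤ ‖F‖²` and slow energy `lowEnergy L ≤ C·(cL²/(n²ν²))·‖F‖²` at a.e. later time;
(C) CORRECTOR CONTENT: from the slow datum `Re e_ℓ·p`, `E_w(t) − lowEnergy(n/2)(w t) ≤ C·(c|ℓ|²/(n²ν²))·E₀`. -/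
def CellEnergyClauses {k : ℕ} (W : LatticeShear.LatticeWord k) (M : ℝ) (hM : 0 < M) (c : ℝ) (lo hi Λ β C ν₀ K : ℝ) : Prop :=
      ∀ ν, ∀ hν : ν ∈ Set.Ioo 0 ν₀, ∀ n : ℕ, ∀ 𝔸 : Torus.Visc4 (Fin 3),
        Torus.OddSmall 𝔸 (ν * β) → (∃ lam ∈ Set.Icc (1:ℝ) Λ, Torus.NearIso 𝔸 (ν * (lo / lam)) (ν * (hi * lam))) →
        (∀ L > (0:ℝ), L * (⌈K / ν⌉₊ : ℝ) ≤ n → ∀ F : VF, IsDatum F →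
            (∀ k' : Fin 3 → ℤ, ‖Torus.latticeVec k'‖ < (n:ℝ) / 2 → ∀ i, modeCoeff k' F i = 0) →
            ∀ T > (0:ℝ), ∀ u : ℝ → VF, Torus.IsWeakTensorPassiveVectorOn 0 T ((1 / (n:ℝ) ^ 2) • 𝔸) (cellField W M hM ν hν.1 n) F u →
              ∀ᵐ t ∂(volume.restrict (Ioo 0 T)),
                ∫ x, ‖u t x‖ ^ 2 ≤ ∫ x, ‖F x‖ ^ 2 ∧ lowEnergy L (u t) ≤ C * (c * L ^ 2 / ((n:ℝ) ^ 2 * ν ^ 2)) * ∫ x, ‖F x‖ ^ 2) ∧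
        ∀ ℓ : Fin 3 → ℤ, ℓ ≠ 0 → ‖Torus.latticeVec ℓ‖ * (⌈K / ν⌉₊ : ℝ) ≤ n →
        ∀ p : EuclideanSpace ℝ (Fin 3), ‖p‖ = 1 → ⟪p, Torus.latticeVec ℓ⟫_ℝ = 0 →
        ∀ T > (0:ℝ), ∀ w : ℝ → VF,
            Torus.IsWeakTensorPassiveVectorOn 0 T ((1 / (n:ℝ) ^ 2) • 𝔸) (cellField W M hM ν hν.1 n) (fun x => (UnitAddTorus.mFourier ℓ x).re • p) w →
            ∀ᵐ t ∂(volume.restrict (Ioo 0 T)),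
              ∫ x, ‖w t x‖ ^ 2 - lowEnergy ((n:ℝ) / 2) (w t)
                  ≤ C * (c * ‖Torus.latticeVec ℓ‖ ^ 2 / ((n:ℝ) ^ 2 * ν ^ 2)) * ∫ x, ‖(UnitAddTorus.mFourier ℓ x).re • p‖ ^ 2

end

end Summit.AnomalousDissipation.AnomalousDissipation.Theorems.SolenoidalFractalHomogenisation.LagrangianStep
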